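import Summits.CriticalPhenomena.CardyFormulaZ2.Theorems.CardyFlipRussoVoronoiHubFromSmirnovDefs
import Literature.Probability.LatticeModels.DelaunayGraph

/-!
# Stub `exists_site_left_of_voronoiCell_bounded` of line `moebius-exact-delaunay-dilation-ward`
# (crux `VoronoiHubFromSmirnov`, stmt-CriticalPhenomena-6433)

BOUNDED VORONOI CELLS SEE SITES ON BOTH SIDES OF EVERY LINE.  Let `ω ⊆ ℂ` be any set of sites, let
`p ≠ q`, and suppose the closed Voronoi cell of `p`
(`Literature.Probability.LatticeModels.voronoiCell ω p = {x | ∀ d ∈ ω, dist x p ≤ dist x d}`) is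
contained in some closed disc `Metric.closedBall p ℓ`.  Then some site `d ∈ ω` lies strictly to the
LEFT of the directed line `p → q`, i.e. `0 < Im (conj (q − p) · (d − p))`.  (Applied to `(p, q)` and
to `(p, 2p − q)` it gives sites strictly on both sides; this is the hypothesis of the Delaunay
pivoting lemma `delaunay_pivot_exists_third` on the "no giant cells" event of I. Benjamini,
O. Schramm, *Conformal invariance of Voronoi percolation*, Comm. Math. Phys. 197 (1998), §4.)

Proof (planar algebra only, no finiteness).  If every site satisfies
`Im (conj (q − p)(d − p)) ≤ 0`, walk from `p` along the left normal `i (q − p)`: for the point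
`c t = p + t · i (q − p)`, `t : ℝ`, and any `d`,

  `dist(d, c t)² − dist(p, c t)² = |d − p|² − 2 t · Im (conj (q − p)(d − p))`   (`vcs_key`),

which is `≥ 0` for `t ≥ 0`, so the whole ray `{c t | t ≥ 0}` lies in the Voronoi cell of `p`
(`vcs_ray_mem_voronoiCell`).  But `dist(c t, p) = t · |q − p|` is unbounded (`vcs_dist_ray`),
contradicting `voronoiCell ω p ⊆ closedBall p ℓ` at `t = (|ℓ| + 1) / |q − p|`.

No new definitions.
-/

noncomputable section

namespace Summit.CriticalPhenomena.CardyFormulaZ2.Cruxes.VoronoiHubFromSmirnov.MoebiusExactDelaunayDilationWard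

/-- **The normal-ray identity.** For the point `c t = p + t · i (q − p)` on the left normal of the
directed line `p → q` through `p` and any point `d`,
`dist(d, c t)² − dist(p, c t)² = |d − p|² − 2 t · Im (conj (q − p)(d − p))`: the power of `d` with
respect to the circle centred at `c t` through `p` is affine in `t`, with slope `−2 σ(d)` given by
the side of the line `p → q` on which `d` lies. [folklore] -/
theorem vcs_key (p q d : ℂ) (t : ℝ) :
    dist d (p + (t : ℂ) * (Complex.I * (q - p))) ^ 2 - dist p (p + (t : ℂ) * (Complex.I * (q - p))) ^ 2 =
      Complex.normSq (d - p) - 2 * t * (starRingEnd ℂ (q - p) * (d - p)).im := by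
  simp only [Complex.dist_eq, Complex.sq_norm, Complex.normSq_apply, Complex.sub_re, Complex.sub_im,
    Complex.add_re, Complex.add_im, Complex.mul_re, Complex.mul_im, Complex.conj_re,
    Complex.conj_im, Complex.ofReal_re, Complex.ofReal_im, Complex.I_re, Complex.I_im]
  ring

/-- The distance from `p` to the point `c t = p + t · i (q − p)` of the normal ray is `t · |q − p|`
for `t ≥ 0`. [folklore] -/
theorem vcs_dist_ray (p q : ℂ) {t : ℝ} (ht : 0 ≤ t) :
    dist (p + (t : ℂ) * (Complex.I * (q - p))) p = t * ‖q - p‖ := by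
  rw [Complex.dist_eq, add_sub_cancel_left, norm_mul, norm_mul, Complex.norm_I, one_mul,
    Complex.norm_real, Real.norm_of_nonneg ht]

/-- **The left normal ray stays in the cell when no site is strictly on the left.** If every site
`d ∈ ω` satisfies `Im (conj (q − p)(d − p)) ≤ 0` (no site strictly to the left of `p → q`), then
every point `p + t · i (q − p)`, `t ≥ 0`, of the left normal ray lies in the Voronoi cell of `p`.
[folklore] -/
theorem vcs_ray_mem_voronoiCell {ω : Set ℂ} {p q : ℂ}
    (h : ∀ d ∈ ω, (starRingEnd ℂ (q - p) * (d - p)).im ≤ 0) {t : ℝ} (ht : 0 ≤ t) :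
    p + (t : ℂ) * (Complex.I * (q - p)) ∈ Literature.Probability.LatticeModels.voronoiCell ω p := by
  intro d hd
  rw [dist_comm _ p, dist_comm _ d, ← sq_le_sq₀ dist_nonneg dist_nonneg]
  have hkey := vcs_key p q d t
  have hσ := h d hd
  nlinarith [Complex.normSq_nonneg (d - p)]

/-- **Bounded Voronoi cells see sites strictly on the left of every line through the site.**  If
`p ≠ q` and the closed Voronoi cell of `p` with respect to `ω` is contained in a closed disc
`closedBall p ℓ`, then some site `d ∈ ω` lies strictly to the left of the directed line `p → q`:
`0 < Im (conj (q − p)(d − p))`.  Otherwise the whole left normal ray through `p` would lie in the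
cell (`vcs_ray_mem_voronoiCell`), which is unbounded. [folklore] -/
theorem exists_site_left_of_voronoiCell_bounded : ∀ (ω : Set ℂ) (p q : ℂ) (ℓ : ℝ), p ≠ q → Literature.Probability.LatticeModels.voronoiCell ω p ⊆ Metric.closedBall p ℓ → ∃ d ∈ ω, 0 < (starRingEnd ℂ (q - p) * (d - p)).im := by
  intro ω p q ℓ hpq hsub
  by_contra h
  push Not at h
  have hn : 0 < ‖q - p‖ := norm_pos_iff.mpr (sub_ne_zero.mpr hpq.symm)
  have ht : 0 ≤ (|ℓ| + 1) / ‖q - p‖ := div_nonneg (by positivity) hn.le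
  have hball := hsub (vcs_ray_mem_voronoiCell h ht)
  rw [Metric.mem_closedBall, vcs_dist_ray p q ht, div_mul_cancel₀ _ hn.ne'] at hball
  linarith [le_abs_self ℓ]

end Summit.CriticalPhenomena.CardyFormulaZ2.Cruxes.VoronoiHubFromSmirnov.MoebiusExactDelaunayDilationWard

end
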